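import Literature.NumberTheory.PAdicHodge.BdRPlusLogLattice
import Literature.NumberTheory.PAdicHodge.CompletedAlgClosurePadicNorm
import Literature.NumberTheory.PAdicHodge.PadicFieldUnitLogHasSum
import HarnessLib

/-!
# `θ` of Fontaine's `p`-adic logarithm: `θ(log(1 + y)) = log_p(1 + θ(y))` in `ℂ_F`

Topic `Literature/NumberTheory/PAdicHodge`; namespace `Literature.NumberTheory.PAdicHodge.GaloisContinuity`. THEOREMS ONLY (no definition,
no instance, no named fact, no `sorry`). Sequel of `BdRPlusLogLattice` / `BdRPlusLogLatticeMul` (`IsLogModFil k y L`: `L ∈ B_dR⁺` is a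
logarithm of `1 + y`, `y ∈ (p, ξ)𝔸_inf`, modulo `Fil^k` for Fontaine's `p`-adic lattice topology) and of `CompletedAlgClosurePadicNorm` /
`PadicFieldUnitLogHasSum` (the logarithm series in `ℂ_F`). For `k ≥ 1` the image of such an `L` under Fontaine's `θ : B_dR⁺ → ℂ_F` is the
ordinary `p`-adic logarithm of the principal unit `θ(1 + y) = 1 + θ(y)` of `ℂ_F` (`‖θ(y)‖ ≤ ‖p‖ < 1`):

* `thetaBdR_logPartialSum` — `θ(P_M(y)) = Σ_{m<M} −(1 − θ(1+y))^{m+1}/(m+1)` (the partial sums of the logarithm series at `θ(1 + y)`);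
* `norm_thetaBdR_lattice_le` — `θ(Λ(j, k)) ⊆ p^j 𝒪_{ℂ_F}` for `k ≥ 1`: `‖θ(ι(p^j a) + ξ^k w)‖ ≤ ‖p‖^j`;
* ★ `IsLogModFil.tendsto_thetaBdR` — `θ(P_M(y)) → θ(L)` in `ℂ_F`;
* ★★ `IsLogModFil.hasSum_thetaBdR` — `HasSum (n ↦ −(1 − θ(1+y))^{n+1}/(n+1)) (θ L)`: **`θ(log(1+y)) = log_p(θ(1+y))`** (the currency of
  `CompletedAlgClosure.hasSum_log_mul` / `exists_pow_prime_pow_eq_one_of_hasSum_log_zero` / `PadicField.hasSum_unitLog_completedAlgClosure`);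
* ★ `IsLogModFil.thetaBdR_eq_algebraMap_unitLog` — if `θ(1 + y) = u ∈ F` (a principal unit of `F`), then `θ(L) = log_p u` (`log_p` of
  `PadicField.normedField`, the (H5) currency): the junction «`θ(log[ũ]) = log_p(ũ♯)`».

Floor (H4)-1d of `Summits/…/Cruxes/StarredOptimalManinUnitFiveSeven/Lines/kato-lever-K3-B2-road.md` (crux K★ `stmt-BirchSwinnertonDyer-22226`):
`θ(X₂) ⊆ ℂ_F` is computed by `log_p`, whence (with `BdRPlusLogLatticeMul`, `TiltUntiltKernel`, `CompletedAlgClosurePadicNorm`)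
`X₂ ∩ Fil¹ = ℚ_p t`. Infrastructure only; BSD / K★ are not proved by any of this.

## References
* J.-M. Fontaine, *Le corps des périodes p-adiques*, Astérisque 223 (1994), Exp. II §1.5.2–1.5.4. [FontaineAsterisque223III]
* J.-M. Fontaine, Y. Ouyang, *Theory of p-adic Galois representations*, §6.1 (`θ(log[x]) = log x^{(0)}`). [FontaineOuyang2022]
-/

noncomputable section

namespace Literature.NumberTheory.PAdicHodge

namespace GaloisContinuity

open ValuativeRel Field Ideal WittVector Finset Filter TruncatedLog
open _root_.Topology
open Literature.NumberTheory.GaloisRepresentations Literature.NumberTheory.GaloisRepresentations.IsNonarchimedeanLocalField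
open Literature.IUT.LogVolume

variable {F : Type} [Field F] [ValuativeRel F] [TopologicalSpace F] [IsNonarchimedeanLocalField F]
  [CharZero F] {p : ℕ} [Fact p.Prime] [Fact (¬ IsUnit (p : integerC F))]
  [IsAdicComplete (Ideal.span {(p : integerC F)}) (integerC F)]

/-! ## §1 `θ` of the partial sums and of the lattices -/

/-- **`θ(P_M(y))` is the `M`-th partial sum of the logarithm series at `θ(1 + y)`**:
`θ(P_M(y)) = Σ_{m<M} −(1 − θ(ι(1+y)))^{m+1}/(m+1)` in `ℂ_F`. [cite: FontaineAsterisque223III, Exp. II §1.5.4] -/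
theorem thetaBdR_logPartialSum (y : Ainf (p := p) F) (M : ℕ) :
    thetaBdR (logPartialSum y M) = ∑ m ∈ range M,
      -((1 - thetaBdR (ainfToBdR (1 + y))) ^ (m + 1)) / (m + 1 : CompletedAlgClosure F) := by
  haveI : CharZero (CompletedAlgClosure F) := charZero_of_injective_algebraMap (algebraMap F (CompletedAlgClosure F)).injective
  rw [logPartialSum_eq_aeval_logTrunc, show thetaBdR (Polynomial.aeval (ainfToBdR y) (logTrunc M)) =
      (thetaBdR (F := F) (p := p)).toRatAlgHom (Polynomial.aeval (ainfToBdR y) (logTrunc M)) from rfl,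
    ← Polynomial.aeval_algHom_apply, aeval_logTrunc]
  refine Finset.sum_congr rfl fun m _ => ?_
  rw [RingHom.toRatAlgHom_apply, eq_ratCast]
  simp only [map_add, map_one, sub_add_cancel_left]
  push_cast
  ring

/-- **`θ` maps the lattice `Λ(j, k)` (`k ≥ 1`) into `p^j 𝒪_{ℂ_F}`**: `‖θ(ι(p^j a) + ξ^k w)‖ ≤ ‖p‖^j` (`θ(ξ) = 0`, `θ(𝔸_inf) = 𝒪_{ℂ_F}`).
[cite: FontaineAsterisque223III, Exp. II §1.5.2] -/
theorem norm_thetaBdR_lattice_le {j k : ℕ} (hk : 1 ≤ k) (a : Ainf (p := p) F) (w : BDeRhamPlus (integerC F) p) :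
    ‖thetaBdR (ainfToBdR ((p : Ainf (p := p) F) ^ j * a) + xiBdR ^ k * w)‖ ≤ ‖(p : CompletedAlgClosure F)‖ ^ j := by
  obtain ⟨k', rfl⟩ := Nat.exists_eq_add_of_le hk
  have h0 : (0 : CompletedAlgClosure F) ^ (1 + k') = 0 := zero_pow (by omega)
  simp only [map_add, map_mul, map_pow, map_natCast, thetaBdR_xiBdR, thetaBdR_ainfToBdR, h0, zero_mul, add_zero, norm_mul,
    norm_pow]
  exact mul_le_of_le_one_right (pow_nonneg (norm_nonneg _) _) (norm_coe_integerC_le _)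

/-- `‖θ(y)‖ ≤ ‖p‖ < 1` for `y ∈ (p, ξ)𝔸_inf`: `θ(1 + y)` is a principal unit of `ℂ_F`. [cite: FontaineAsterisque223III, Exp. II §1.5.2] -/
theorem norm_one_sub_thetaBdR_lt_one {y : Ainf (p := p) F} (hy : y ∈ Ideal.span {(p : Ainf (p := p) F), xi}) :
    ‖1 - thetaBdR (ainfToBdR (1 + y))‖ < 1 := by
  obtain ⟨a, b, rfl⟩ := Ideal.mem_span_pair.1 hy
  simp only [map_add, map_one, map_mul, map_natCast, ainfToBdR_xi, thetaBdR_xiBdR, mul_zero, add_zero, thetaBdR_ainfToBdR,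
    sub_add_cancel_left, norm_neg, norm_mul]
  exact (mul_le_of_le_one_left (norm_nonneg _) (norm_coe_integerC_le _)).trans_lt norm_natCast_C_lt_one'

/-! ## §2 `θ(L) = log_p(θ(1 + y))` -/

/-- ★ **`θ(P_M(y)) → θ(L)` in `ℂ_F`** for a logarithm `L` of `1 + y` modulo `Fil^k`, `k ≥ 1` (`L − P_M(y) ∈ Λ(j, k)` for `M ≫ 0` and
`‖θ(Λ(j,k))‖ ≤ ‖p‖^j → 0`). [cite: FontaineAsterisque223III, Exp. II §1.5.4] -/
theorem IsLogModFil.tendsto_thetaBdR {k : ℕ} (hk : 1 ≤ k) {y : Ainf (p := p) F} {L : BDeRhamPlus (integerC F) p}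
    (hL : IsLogModFil k y L) : Tendsto (fun M => thetaBdR (logPartialSum y M)) atTop (𝓝 (thetaBdR L)) := by
  rw [Metric.tendsto_atTop]
  intro ε hε
  obtain ⟨j, hj⟩ := exists_pow_lt_of_lt_one hε (norm_natCast_C_lt_one' (F := F) (p := p))
  obtain ⟨M₀, hM₀⟩ := hL j
  refine ⟨M₀, fun M hM => ?_⟩
  obtain ⟨a, w, h⟩ := hM₀ M hM
  rw [dist_eq_norm, ← norm_neg, neg_sub, ← map_sub, h]
  exact (norm_thetaBdR_lattice_le hk a w).trans_lt hj

/-- ★★ **`θ(log(1 + y)) = log_p(θ(1 + y))`.** For `y ∈ (p, ξ)𝔸_inf`, `k ≥ 1` and a logarithm `L` of `1 + y` modulo `Fil^k B_dR⁺`, the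
logarithm series of the principal unit `x = θ(ι(1 + y))` of `ℂ_F` sums to `θ(L)`: `HasSum (n ↦ −(1 − x)^{n+1}/(n+1)) (θ L)`
(limits are unique; the series converges by the `ℚ_p`-Banach structure of `ℂ_F`, `PadicCompletedAlgClosure`).
[cite: FontaineAsterisque223III, Exp. II §1.5.4] [cite: FontaineOuyang2022, §6.1] -/
theorem IsLogModFil.hasSum_thetaBdR (hp : valuation F p < 1) {k : ℕ} (hk : 1 ≤ k) {y : Ainf (p := p) F}
    (hy : y ∈ Ideal.span {(p : Ainf (p := p) F), xi}) {L : BDeRhamPlus (integerC F) p} (hL : IsLogModFil k y L) :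
    HasSum (fun n : ℕ => -((1 - thetaBdR (ainfToBdR (1 + y))) ^ (n + 1)) / (n + 1 : CompletedAlgClosure F)) (thetaBdR L) := by
  set x : CompletedAlgClosure F := thetaBdR (ainfToBdR (1 + y)) with hx
  -- the series converges (to `logSeries` of the synonym)
  let x' : PadicCompletedAlgClosure F p hp := (PadicCompletedAlgClosure.toC hp).symm x
  have hx' : ‖1 - x'‖ < 1 := by
    rw [PadicCompletedAlgClosure.norm_lt_one_iff, map_sub, map_one, RingEquiv.apply_symm_apply]
    exact norm_one_sub_thetaBdR_lt_one hy
  have key : HasSum (fun n : ℕ => -((1 - PadicCompletedAlgClosure.toC hp x') ^ (n + 1)) / (n + 1 : CompletedAlgClosure F))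
      (PadicCompletedAlgClosure.toC hp (logSeries x')) :=
    (PadicCompletedAlgClosure.hasSum_iff hp).1 (hasSum_logSeries p hx')
  rw [RingEquiv.apply_symm_apply] at key
  -- and its partial sums are `θ(P_M(y)) → θ(L)`
  have h2 : Tendsto (fun M => ∑ m ∈ range M, -((1 - x) ^ (m + 1)) / (m + 1 : CompletedAlgClosure F)) atTop (𝓝 (thetaBdR L)) := by
    simpa only [thetaBdR_logPartialSum] using hL.tendsto_thetaBdR hk
  rwa [← tendsto_nhds_unique key.tendsto_sum_nat h2]

/-- ★ **The junction with `log_p` of `F`**: if moreover `θ(ι(1 + y)) = u` for a (principal) unit `u ∈ F`, then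
`θ(L) = log_p(u)` in `ℂ_F` (`log_p = unitLog` of `PadicField.normedField F p hp`) — e.g. `y = [ũ] − 1` for a unit `u ≡ 1 (mod p)` of `F`
and its tilt `ũ`: «`θ(log[ũ]) = log_p(u)`». [cite: FontaineAsterisque223III, Exp. II §1.5.4] [cite: FontaineOuyang2022, §6.1] -/
theorem IsLogModFil.thetaBdR_eq_algebraMap_unitLog (hp : valuation F p < 1) {k : ℕ} (hk : 1 ≤ k) {y : Ainf (p := p) F}
    (hy : y ∈ Ideal.span {(p : Ainf (p := p) F), xi}) {L : BDeRhamPlus (integerC F) p} (hL : IsLogModFil k y L) {u : F}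
    (hu : thetaBdR (ainfToBdR (1 + y)) = algebraMap F (CompletedAlgClosure F) u) :
    thetaBdR L = algebraMap F (CompletedAlgClosure F) (letI := PadicField.normedField F p hp; unitLog u) := by
  have hu1 : valuation F (1 - u) < 1 := by
    have h := norm_one_sub_thetaBdR_lt_one hy
    rw [hu, ← map_one (algebraMap F (CompletedAlgClosure F)), ← map_sub] at h
    letI := IsNonarchimedeanLocalField.nontriviallyNormedField F
    rw [CompletedAlgClosure.norm_algebraMap] at h
    exact (IsNonarchimedeanLocalField.norm_lt_one_iff F (1 - u)).1 h
  have h1 := hL.hasSum_thetaBdR hp hk hy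
  rw [hu] at h1
  exact h1.unique (PadicField.hasSum_unitLog_completedAlgClosure F p hp hu1)

end GaloisContinuity

end Literature.NumberTheory.PAdicHodge

end
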